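import Summits.ValiantsHypothesis.ValiantsHypothesis.Theorems.BarrierLeverChowBenchmarkPairsDirichletSplit

/-!
# Route BarrierLever — item 22038 `ChowBenchmarkPairs`, line `moore-peel`: segment mean-value unisolvence
# `SegmentMeanValueAt h` for EVERY `h ≤ 182`, BY NAME (the full certified peel window of node #1)

Helper file (`--supports stmt-ValiantsHypothesis-22038`; cell valiant-natproofs, rung V4, 𝒟-side benchmark of
record, line `moore_peel`, planner flags HOME/STATUS.md l.1623 / l.1641; seat val-np-p4 gen 28).  Closes NO item.
No new definition.

The line file's node #1 `stub_segmentMeanValue` is `∀ h, SegmentMeanValueAt h`.  Its unconditional range in the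
tree so far: `h ≤ 14` by kernel-checked split certificates (`segmentMeanValueAt_of_le_fourteen`,
`…SplitCertInstancesB`) and `h ≤ 52` through THEOREM A^κ and the integer certificates `det G_i ≠ 0`, `i ≤ 52`
(`kernelPoisedAt_factorial_of_le_52`, `…DirichletPeel`).  THEOREM W (`…DirichletSplit`, val-np-p4 g27) decides
`det G_i = 0 ↔ badStage i` and gives `det G_i ≠ 0` for every `1 ≤ i ≤ 182` in one `decide`
(`det_peelMatrix_ne_zero_of_le_182_by_W`); feeding it to THEOREM A^κ (`kernelPoisedAt_factorial_of_peel`,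
`…KernelPoised`) yields the whole certified window of the hierarchical Moore peel:

* `kernelPoisedAt_factorial_of_le_182` — `KernelPoisedAt Nat.factorial h` for every `h ≤ 182`;
* **`segmentMeanValueAt_of_le_182`** — the line file's `SegmentMeanValueAt h` VERBATIM for every `h ≤ 182`
  (the two texts are definitionally equal: `kerE Nat.factorial` is `segEntry`).

`h = 182` is the END of this road: `det G_183 = 0` (`badStage_183`; `infinite_badStages`), so `h ≥ 183` needs a
certificate the one-point peel does not see (memo MEMO-g18 §3bis certifies `h ≤ 1 100` numerically by detours and
residuals; nothing of that is in the kernel).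

WHAT THIS IS NOT: the stub `stub_segmentMeanValue` (∀h) is untouched; nothing on crux stmt-ValiantsHypothesis-14610
or on `VP` versus `VNP`.
-/

set_option linter.dupNamespace false

namespace Summit.ValiantsHypothesis.ValiantsHypothesis.Theorems.BarrierLever.MoorePeel

/-- **`KernelPoisedAt Nat.factorial h` for every `h ≤ 182`**: THEOREM A^κ (`kernelPoisedAt_factorial_of_peel`)
fed with THEOREM W's window `det G_i ≠ 0`, `1 ≤ i ≤ 182` (`det_peelMatrix_ne_zero_of_le_182_by_W`). -/
theorem kernelPoisedAt_factorial_of_le_182 (h : ℕ) (hh : h ≤ 182) : KernelPoisedAt Nat.factorial h :=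
  kernelPoisedAt_factorial_of_peel h fun i hi hih => det_peelMatrix_ne_zero_of_le_182_by_W i (hih.trans hh) hi

/-- **Segment mean-value unisolvence `SegmentMeanValueAt h` for every `h ≤ 182`** — the statement of the line
file's node #1 `stub_segmentMeanValue`, verbatim, on the full certified window of the hierarchical Moore peel
(node #1's unconditional range by name: `52 → 182`). -/
theorem segmentMeanValueAt_of_le_182 (h : ℕ) (hh : h ≤ 182) :
    ∀ (r : ℕ) (u : Fin r → Finset (Fin h)), Function.Injective u → (∀ i, (u i).card ≤ 2) →
      (∀ S : Finset (Fin h), S.card ≤ 2 → ∃ i, u i = S) →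
      ∃ P : Fin h → Fin h → ℂ,
        (Matrix.of fun i j : Fin r =>
          ∑ g : (↥(benchCols h r j) → ↥(u i)), (∏ c : ↥(benchCols h r j), P (g c) c) *
            ∏ a : ↥(u i),
              ((Finset.univ.filter fun c : ↥(benchCols h r j) => g c = a).card.factorial : ℂ)).det ≠ 0 :=
  kernelPoisedAt_factorial_of_le_182 h hh

end Summit.ValiantsHypothesis.ValiantsHypothesis.Theorems.BarrierLever.MoorePeel
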